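import Literature.Barriers.MatrixMultiplication.IrreversibilityBarrierGaugeBounds
import Literature.Barriers.MatrixMultiplication.IrreversibilityBarrierAssembly
import HarnessLib

/-!
# The balanced big centroid tensors (Kassabov–Landsberg–Souza–Speegle 2026) are irreversible

Solo programme `solo-MatrixMultiplication-informed` (gen 55), claims c459–c460: the literature
watch of 2026-08-28 (arXiv:2608.27434, posted 2026-08-27) placed, in the kernel, against
constraint C2 of the programme's sharpest statement (`sharpest-statement.md` §1, `EXECUTIVE.md`
§2) — the Christandl–Vrana–Zuiddam irreversibility barrier (`IrreversibilityBarrier_holds`).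

Kassabov–Landsberg–Souza–Speegle introduce the **big centroid tensors**
`T^{bigcen}_{p,q,r} = Σ_{j,k} a_{jk} b_j c_k + Σ_{i,k} a_i b_{ik} c_k + Σ_{i,j} a_i b_j c_{ij}
 ∈ K^{qr+p} ⊗ K^{pr+q} ⊗ K^{pq+r}` (a nearly disjoint sum `M⟨p,q,1⟩ + M⟨p,1,r⟩ + M⟨1,q,r⟩`,
Ex. 2.2), prove that the BALANCED member `T_n := T^{bigcen}_{n,n,n} ∈ (K^{n²+n})^{⊗3}` has
minimal border rank `n² + n` over every field `K ≠ 𝔽₂` (Thm. 2.7: "thus they are potentially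
useful for constructing fast matrix multiplication algorithms"), run the laser method on small
members (Table 1: `ω ≤ 2.5` through `T_{2,2,2}`, `ω ≤ 2.46016` through `T_{1,1,4}`), and report
that `Q̃(T_n)` lies between `n^{4/3}` and a constant times `n^{4/3}` (Rem. 5.4, crediting
H. Nieuwboer).

**This file** (any field `K`, `n ≥ 2`; `n = 1` is the W-state `cw_1` of `irreversibilityBarrier_cw`):
* `bigcenTensor K n` — `T_n` on the index type `(Fin n × Fin n) ⊕ Fin n` of each factor;
* `flatteningRank_bigcenTensor` — `ζ⁽¹⁾(T_n) = n² + n`, whence `ω(⟨2⟩, T_n) ≥ log₂(n² + n)`;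
* `inv_le_relativeExponent_bigcenTensor_unit` — the cross-entropy certificate
  `w(a_{jk}) = 1/(3n²)`, `w(a_i) = 2/(3n)` (same on `B`, `C`), whose product is `4/(27 n⁴)` at
  EVERY support point, gives `Q̃(T_n) ≤ (27/4)^{1/3} · n^{4/3} = 1.8899 · n^{4/3}`, i.e.
  `ω(T_n, ⟨2⟩) ≥ 1/(log₂ 3 − 2/3 + (4/3) log₂ n)` (an explicit form of the upper bound of Rem. 5.4;
  it is the uniform Strassen upper support functional of `T_n` in the given bases, and by the
  `ℤ/3`-symmetry of `T_n` and convexity in `θ` no other `θ` does better there);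
* `two_irreversibility_bigcenTensor_ge` — `2 i(T_n) ≥ 2 log₂(n²+n)/(log₂ 3 − 2/3 + (4/3) log₂ n)`;
* `irreversibilityBarrier_bigcen` — by CVZ Thm. 9, the bound on `ω` certified through the FIXED
  intermediate tensor `T_n` by any method of the class (laser method with arbitrary Kronecker
  powers and any restriction / degeneration of powers of `T_n` to matrix multiplication) satisfies
  `ω(⟨2⟩, T_n) · ω(T_n, ⟨2,2,2⟩) ≥ 2 log₂(n²+n)/(log₂ 3 − 2/3 + (4/3) log₂ n)`;
* `irreversibilityBarrier_bigcen_gt_two` — that number is `> 2` for every `n ≥ 2`; numerically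
  `2.2961` (`n = 2`, format `6 × 6 × 6`), `2.3650` (`n = 3`), `2.4114` (`n = 4`), increasing
  to `3`.

**Verdict for the dossier.** No balanced big centroid tensor can carry a proof of `ω = 2` (nor of
any bound below `2.296`): the family is tight-supported, unstable and irreversible, i.e. it falls
under constraint C2 (with `CW_q`, `cw_q` for `q ≥ 3`, `W`) and moves none of the doors D1–D12 of
`EXECUTIVE.md` §3. Not treated here: the
Strassen-like members `T_{1,1,r}` of KLSS Table 1 (first flattening rank `r + 1`; the same
uniform-by-block certificate only gives `Q̃ ≤ (27/4)^{1/3} r^{2/3}`, which ties with `r + 1 = 3` at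
`r = 2` and yields the weak values `2.03 / 2.06 / 2.10` at `r = 3 / 4 / 5`), and the qualitative
alternative through Theorem R of `SoloInformedReversibleUnit` (minimal border rank ⟹ 111-abundant
⟹ irreversible unless `≅ ⟨d⟩`), which would import the unformalised Thm. 2.7.

References: [cite: KassabovEtAl2026, Ex. 2.2, Thm. 2.7, Table 1, Rem. 5.4] (arXiv:2608.27434);
[cite: ChristandlVranaZuiddam2021, Def. 4, Thm. 9, Prop. 17, §4.2].
-/

open scoped BigOperators

namespace Summit.MatrixMultiplication.MatrixMultiplication.Theorems

open Literature.Computability.AlgebraicComplexity Literature.Barriers.MatrixMultiplication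

namespace BigCentroid

/-! ## The tensor -/

/-- Index type of each factor of `T_n`: the "matrix" coordinates (`a_{jk}`, resp. `b_{ik}`, `c_{ij}`)
and the "vector" coordinates (`a_i`, resp. `b_j`, `c_k`). [cite: KassabovEtAl2026, Ex. 2.2] -/
abbrev Idx (n : ℕ) : Type := (Fin n × Fin n) ⊕ Fin n

/-- `|(Fin n × Fin n) ⊕ Fin n| = n² + n`. [folklore] -/
theorem card_idx (n : ℕ) : Fintype.card (Idx n) = n ^ 2 + n := by
  simp [Fintype.card_sum, Fintype.card_prod, Fintype.card_fin, sq]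

variable (K : Type) [Field K]

/-- The **balanced big centroid tensor** `T_n = T^{bigcen}_{n,n,n}
= Σ_{j,k} a_{jk} b_j c_k + Σ_{i,k} a_i b_{ik} c_k + Σ_{i,j} a_i b_j c_{ij}`.
[cite: KassabovEtAl2026, Ex. 2.2] -/
def bigcenTensor (n : ℕ) : Idx n → Idx n → Idx n → K
  | Sum.inl p, Sum.inr j, Sum.inr k => if p = (j, k) then 1 else 0
  | Sum.inr i, Sum.inl p, Sum.inr k => if p = (i, k) then 1 else 0
  | Sum.inr i, Sum.inr j, Sum.inl p => if p = (i, j) then 1 else 0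
  | Sum.inl _, Sum.inl _, _ => 0
  | Sum.inl _, Sum.inr _, Sum.inl _ => 0
  | Sum.inr _, Sum.inl _, Sum.inl _ => 0
  | Sum.inr _, Sum.inr _, Sum.inr _ => 0

variable {K} {n : ℕ}

/-- Entry `(a_{jk}, b_{j'}, c_{k'})`. [cite: KassabovEtAl2026, Ex. 2.2] -/
@[simp] theorem bigcen_lrr (p : Fin n × Fin n) (j k : Fin n) :
    bigcenTensor K n (Sum.inl p) (Sum.inr j) (Sum.inr k) = if p = (j, k) then 1 else 0 := rfl

/-- Entry `(a_i, b_{i'k}, c_{k'})`. [cite: KassabovEtAl2026, Ex. 2.2] -/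
@[simp] theorem bigcen_rlr (i : Fin n) (p : Fin n × Fin n) (k : Fin n) :
    bigcenTensor K n (Sum.inr i) (Sum.inl p) (Sum.inr k) = if p = (i, k) then 1 else 0 := rfl

/-- Entry `(a_i, b_j, c_{i'j'})`. [cite: KassabovEtAl2026, Ex. 2.2] -/
@[simp] theorem bigcen_rrl (i j : Fin n) (p : Fin n × Fin n) :
    bigcenTensor K n (Sum.inr i) (Sum.inr j) (Sum.inl p) = if p = (i, j) then 1 else 0 := rfl

/-- Two "matrix" coordinates in `A` and `B` never meet the support. [cite: KassabovEtAl2026, Ex. 2.2] -/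
@[simp] theorem bigcen_ll (p p' : Fin n × Fin n) (c : Idx n) :
    bigcenTensor K n (Sum.inl p) (Sum.inl p') c = 0 := by cases c <;> rfl

/-- Matrix coordinates in `A` and `C`: zero. [cite: KassabovEtAl2026, Ex. 2.2] -/
@[simp] theorem bigcen_lrl (p : Fin n × Fin n) (j : Fin n) (p' : Fin n × Fin n) :
    bigcenTensor K n (Sum.inl p) (Sum.inr j) (Sum.inl p') = 0 := rfl

/-- Matrix coordinates in `B` and `C`: zero. [cite: KassabovEtAl2026, Ex. 2.2] -/
@[simp] theorem bigcen_rll (i : Fin n) (p p' : Fin n × Fin n) :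
    bigcenTensor K n (Sum.inr i) (Sum.inl p) (Sum.inl p') = 0 := rfl

/-- Three "vector" coordinates: zero. [cite: KassabovEtAl2026, Ex. 2.2] -/
@[simp] theorem bigcen_rrr (i j k : Fin n) :
    bigcenTensor K n (Sum.inr i) (Sum.inr j) (Sum.inr k) = 0 := rfl

/-! ## `R̃`-side: the first flattening of `T_n` is injective -/

/-- The `x`-slices of `T_n` are linearly independent (each slice owns a private coordinate:
`(b_j, c_k)` for `a_{jk}`, `(b_{ik}, c_k)` for `a_i`). [cite: KassabovEtAl2026, Ex. 2.2] -/
theorem linearIndependent_xSlices_bigcen (hn : 1 ≤ n) :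
    LinearIndependent K (xSlices (bigcenTensor K n)) := by
  rw [Fintype.linearIndependent_iff]
  intro g hg
  have ev : ∀ b c : Idx n, ∑ a, g a * bigcenTensor K n a b c = 0 := fun b c => by
    have h := congr_fun hg (b, c)
    simpa [Finset.sum_apply, Pi.smul_apply, smul_eq_mul] using h
  rintro (⟨j, k⟩ | i)
  · have h := ev (Sum.inr j) (Sum.inr k)
    rw [Finset.sum_eq_single (Sum.inl (j, k) : Idx n) (fun b _ hb => ?_) (by simp)] at h
    · simpa using h
    · rcases b with p | i
      · have hp : p ≠ (j, k) := fun e => hb (by rw [e])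
        simp [hp]
      · simp
  · have k₀ : Fin n := ⟨0, hn⟩
    have h := ev (Sum.inl (i, k₀)) (Sum.inr k₀)
    rw [Finset.sum_eq_single (Sum.inr i : Idx n) (fun b _ hb => ?_) (by simp)] at h
    · simpa using h
    · rcases b with p | i'
      · simp
      · have hi : (i, k₀) ≠ (i', k₀) := fun e => hb (by rw [(Prod.mk.inj e).1])
        simp [hi]

/-- **`ζ⁽¹⁾(T_n) = n² + n`** (the first flattening of `T_n` is injective; `T_n` is concise).
[cite: KassabovEtAl2026, Ex. 2.2] -/
theorem flatteningRank_bigcenTensor (hn : 1 ≤ n) : flatteningRank (bigcenTensor K n) = n ^ 2 + n := by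
  rw [flatteningRank, finrank_span_eq_card (linearIndependent_xSlices_bigcen hn), card_idx]

/-- **`ω(⟨2⟩, T_n) ≥ log₂(n² + n)`** (flattening lower bound for `R̃`, CVZ Prop. 17).
[cite: ChristandlVranaZuiddam2021, Prop. 17] -/
theorem logb_le_relativeExponent_unit_bigcenTensor (hn : 1 ≤ n) :
    Real.logb 2 ((n : ℝ) ^ 2 + n) ≤ relativeExponent (unitTensor K 2) (bigcenTensor K n) := by
  have h := logb_flatteningRank_le_relativeExponent (K := K) (bigcenTensor K n)
  rw [flatteningRank_bigcenTensor hn] at h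
  push_cast at h
  exact h

/-! ## `Q̃`-side: the cross-entropy certificate -/

/-- The weights `w(a_{jk}) = 1/(3n²)`, `w(a_i) = 2/(3n)` (the one-body marginals of the uniform
distribution on the support of `T_n`). [cite: ChristandlVranaZuiddam2021, §4.2] -/
noncomputable def bcWeight (n : ℕ) : Idx n → ℝ :=
  Sum.elim (fun _ => 1 / (3 * (n : ℝ) ^ 2)) (fun _ => 2 / (3 * (n : ℝ)))

/-- The weights are nonnegative. [folklore] -/
theorem bcWeight_nonneg (n : ℕ) (a : Idx n) : 0 ≤ bcWeight n a := by
  rcases a with p | i <;> simp only [bcWeight, Sum.elim_inl, Sum.elim_inr] <;> positivity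

/-- Total mass `n² · 1/(3n²) + n · 2/(3n) = 1`. [folklore] -/
theorem sum_bcWeight (hn : 1 ≤ n) : ∑ a, bcWeight n a = 1 := by
  have hn0 : (n : ℝ) ≠ 0 := by exact_mod_cast (show n ≠ 0 by omega)
  simp only [bcWeight, Fintype.sum_sum_type, Sum.elim_inl, Sum.elim_inr, Finset.sum_const,
    Finset.card_univ, Fintype.card_prod, Fintype.card_fin, nsmul_eq_mul]
  push_cast
  field_simp
  ring

/-- `θ_n = (4/(27 n⁴))^{1/3}`, so that `1/θ_n = (27/4)^{1/3} n^{4/3}` is the certified upper bound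
for `Q̃(T_n)`. [cite: ChristandlVranaZuiddam2021, §4.2] -/
noncomputable def bcTheta (n : ℕ) : ℝ := (4 / (27 * (n : ℝ) ^ 4)) ^ ((3 : ℝ)⁻¹)

/-- `4/(27 n⁴) > 0` (`n ≥ 1`). [folklore] -/
theorem bcTheta_arg_pos (hn : 1 ≤ n) : (0 : ℝ) < 4 / (27 * (n : ℝ) ^ 4) := by
  have hn0 : (0 : ℝ) < n := by exact_mod_cast hn
  positivity

/-- `θ_n > 0` (`n ≥ 1`). [folklore] -/
theorem bcTheta_pos (hn : 1 ≤ n) : 0 < bcTheta n :=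
  Real.rpow_pos_of_pos (bcTheta_arg_pos hn) _

/-- `θ_n³ = 4/(27 n⁴)`. [folklore] -/
theorem bcTheta_pow_three (n : ℕ) : bcTheta n ^ 3 = 4 / (27 * (n : ℝ) ^ 4) := by
  unfold bcTheta
  have h := Real.rpow_inv_natCast_pow (x := 4 / (27 * (n : ℝ) ^ 4)) (n := 3) (by positivity)
    (by norm_num)
  push_cast at h
  exact h

/-- `θ_n < 1` (`n ≥ 1`: `4 < 27 n⁴`). [folklore] -/
theorem bcTheta_lt_one (hn : 1 ≤ n) : bcTheta n < 1 := by
  have hn1 : (1 : ℝ) ≤ n := by exact_mod_cast hn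
  have h4 : (1 : ℝ) ≤ (n : ℝ) ^ 4 := one_le_pow₀ hn1
  unfold bcTheta
  refine Real.rpow_lt_one (bcTheta_arg_pos hn).le ?_ (by norm_num)
  rw [div_lt_one (by positivity)]
  linarith

/-- `log₂(1/θ_n) = log₂ 3 − 2/3 + (4/3) log₂ n`. [folklore] -/
theorem logb_inv_bcTheta (hn : 1 ≤ n) :
    Real.logb 2 (1 / bcTheta n) = Real.logb 2 3 - 2 / 3 + 4 / 3 * Real.logb 2 n := by
  have hn0 : (0 : ℝ) < n := by exact_mod_cast hn
  rw [one_div, Real.logb_inv, bcTheta, Real.logb_rpow_eq_mul_logb_of_pos (bcTheta_arg_pos hn),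
    Real.logb_div (by norm_num) (by positivity), Real.logb_mul (by norm_num) (by positivity),
    Real.logb_pow, show (27 : ℝ) = 3 ^ 3 by norm_num, Real.logb_pow,
    show (4 : ℝ) = 2 ^ 2 by norm_num, Real.logb_pow, Real.logb_self_eq_one one_lt_two]
  push_cast
  ring

/-- **The certificate covers the support with equality**: at every support point of `T_n` the
weight product is exactly `(1/(3n²)) · (2/(3n)) · (2/(3n)) = 4/(27 n⁴) = θ_n³`.
[cite: KassabovEtAl2026, Ex. 2.2] -/
theorem bcWeight_supp (n : ℕ) : ∀ a b c, bigcenTensor K n a b c ≠ 0 →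
    bcTheta n ^ 3 ≤ bcWeight n a * bcWeight n b * bcWeight n c := by
  intro a b c h
  rw [bcTheta_pow_three]
  rcases a with p | i <;> rcases b with p' | j <;> rcases c with p'' | k <;>
    simp only [bigcen_ll, bigcen_lrl, bigcen_rll, bigcen_rrr, ne_eq, not_true_eq_false] at h <;>
    simp only [bcWeight, Sum.elim_inl, Sum.elim_inr] <;> apply le_of_eq <;> ring

/-- **`T_n ≥ ⟨2⟩`** (`n ≥ 2`): zero out to `a ∈ {a_{00}, a_{11}}`, `b ∈ {b_0, b_1}`, `c ∈ {c_0, c_1}`.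
[folklore] -/
theorem tensorRestrictsTo_bigcen_unitTensor_two (hn : 2 ≤ n) :
    TensorRestrictsTo (kroneckerPow (bigcenTensor K n) 1) (unitTensor K 2) := by
  set f : Fin 2 → Fin n := Fin.castLE hn with hf
  have key : unitTensor K 2 = fun x y z => kroneckerPow (bigcenTensor K n) 1
      (fun _ => (Sum.inl (f x, f x) : Idx n)) (fun _ => (Sum.inr (f y) : Idx n))
      (fun _ => (Sum.inr (f z) : Idx n)) := by
    funext x y z
    fin_cases x <;> fin_cases y <;> fin_cases z <;>
      simp [kroneckerPow_apply, hf, Fin.ext_iff]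
  rw [key]
  exact tensorRestrictsTo_precomp _ _ _ _

/-- `log₂ 3 − 2/3 + (4/3) log₂ n > 0` (`n ≥ 1`). [folklore] -/
theorem bcExponent_pos (hn : 1 ≤ n) : 0 < Real.logb 2 3 - 2 / 3 + 4 / 3 * Real.logb 2 n := by
  have h1 : 1 ≤ Real.logb 2 3 := by
    rw [← Real.logb_self_eq_one one_lt_two]
    exact Real.logb_le_logb_of_le one_lt_two (by norm_num) (by norm_num)
  have h2 : 0 ≤ Real.logb 2 n := Real.logb_nonneg one_lt_two (by exact_mod_cast hn)
  linarith

/-- **`ω(T_n, ⟨2⟩) ≥ 1/(log₂ 3 − 2/3 + (4/3) log₂ n)`**, i.e. `Q̃(T_n) ≤ (27/4)^{1/3} n^{4/3}`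
(`n ≥ 2`; CVZ §4.2 with the certificate `bcWeight`). [cite: ChristandlVranaZuiddam2021, §4.2]
[cite: KassabovEtAl2026, Rem. 5.4] -/
theorem inv_le_relativeExponent_bigcenTensor_unit (hn : 2 ≤ n) :
    1 / (Real.logb 2 3 - 2 / 3 + 4 / 3 * Real.logb 2 n) ≤
      relativeExponent (bigcenTensor K n) (unitTensor K 2) := by
  have hn1 : 1 ≤ n := by omega
  have h := inv_logb_le_relativeExponent_of_weights (bigcenTensor K n) (bcWeight n) (bcWeight n)
    (bcWeight n) (bcWeight_nonneg n) (bcWeight_nonneg n) (bcWeight_nonneg n) (sum_bcWeight hn1).le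
    (sum_bcWeight hn1).le (sum_bcWeight hn1).le (bcTheta_pos hn1) (bcTheta_lt_one hn1)
    (bcWeight_supp (K := K) n) (tensorRestrictsTo_bigcen_unitTensor_two hn)
  rwa [logb_inv_bcTheta hn1] at h

/-! ## Irreversibility and the barrier -/

/-- **`2 i(T_n) ≥ 2 log₂(n²+n) / (log₂ 3 − 2/3 + (4/3) log₂ n)`** (`n ≥ 2`).
[cite: ChristandlVranaZuiddam2021, Def. 4 and Prop. 17] [cite: KassabovEtAl2026, Rem. 5.4] -/
theorem two_irreversibility_bigcenTensor_ge (hn : 2 ≤ n) :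
    2 * Real.logb 2 ((n : ℝ) ^ 2 + n) / (Real.logb 2 3 - 2 / 3 + 4 / 3 * Real.logb 2 n) ≤
      2 * irreversibility (bigcenTensor K n) := by
  have hn1 : 1 ≤ n := by omega
  have hc := bcExponent_pos hn1
  have hA := logb_le_relativeExponent_unit_bigcenTensor (K := K) hn1
  have hB := inv_le_relativeExponent_bigcenTensor_unit (K := K) hn
  have hn0 : (1 : ℝ) ≤ n := by exact_mod_cast hn1
  have hlog0 : 0 ≤ Real.logb 2 ((n : ℝ) ^ 2 + n) := Real.logb_nonneg one_lt_two (by nlinarith)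
  have hprod : Real.logb 2 ((n : ℝ) ^ 2 + n) * (1 / (Real.logb 2 3 - 2 / 3 + 4 / 3 * Real.logb 2 n))
      ≤ irreversibility (bigcenTensor K n) := by
    unfold irreversibility
    exact mul_le_mul hA hB (by positivity) (relativeExponent_nonneg _ _)
  calc 2 * Real.logb 2 ((n : ℝ) ^ 2 + n) / (Real.logb 2 3 - 2 / 3 + 4 / 3 * Real.logb 2 n)
      = 2 * (Real.logb 2 ((n : ℝ) ^ 2 + n) *
          (1 / (Real.logb 2 3 - 2 / 3 + 4 / 3 * Real.logb 2 n))) := by ring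
    _ ≤ 2 * irreversibility (bigcenTensor K n) := by linarith

/-- `T_n` is not a triad `w ⊗ u ⊗ v` (CVZ Assumption 1; `n ≥ 2`): the entries at
`(a_{00}, b_0, c_0)`, `(a_{00}, b_0, c_1)`, `(a_{01}, b_0, c_1)` are `1, 0, 1`. [folklore] -/
theorem bigcenTensor_ne_triad (hn : 2 ≤ n) (w u v : Idx n → K) :
    bigcenTensor K n ≠ triad w u v := by
  intro h
  set j : Fin n := ⟨0, by omega⟩ with hj
  set k : Fin n := ⟨1, by omega⟩ with hk
  have hjk : j ≠ k := by simp [hj, hk, Fin.ext_iff]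
  have h1 := congrFun (congrFun (congrFun h (Sum.inl (j, j))) (Sum.inr j)) (Sum.inr j)
  have h2 := congrFun (congrFun (congrFun h (Sum.inl (j, j))) (Sum.inr j)) (Sum.inr k)
  have h3 := congrFun (congrFun (congrFun h (Sum.inl (j, k))) (Sum.inr j)) (Sum.inr k)
  simp only [bigcen_lrr, triad_apply, Prod.mk.injEq, true_and, if_true, hjk, if_false] at h1 h2 h3
  rcases mul_eq_zero.1 h2.symm with hwu | hv
  · rw [hwu] at h1; simp at h1
  · rw [hv] at h3; simp at h3

/-- **The irreversibility barrier for the balanced big centroid tensors** (any field, `n ≥ 2`):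
every upper bound on `ω` certified through the fixed intermediate tensor `T_n` is at least
`2 log₂(n²+n) / (log₂ 3 − 2/3 + (4/3) log₂ n)` (`= 2.2961` at `n = 2`, `2.3650` at `n = 3`,
`2.4114` at `n = 4`, `↑ 3`). [cite: ChristandlVranaZuiddam2021, Thm. 9]
[cite: KassabovEtAl2026, Thm. 2.7 and Rem. 5.4] -/
theorem irreversibilityBarrier_bigcen (K : Type) [Field K] (hn : 2 ≤ n) :
    2 * Real.logb 2 ((n : ℝ) ^ 2 + n) / (Real.logb 2 3 - 2 / 3 + 4 / 3 * Real.logb 2 n) ≤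
      relativeExponent (unitTensor K 2) (bigcenTensor K n) *
        relativeExponent (bigcenTensor K n) (matMulTensor K 2 2 2) :=
  (two_irreversibility_bigcenTensor_ge hn).trans
    (IrreversibilityBarrier_holds.thm9 K (bigcenTensor K n) (bigcenTensor_ne_triad hn))

/-- The barrier value exceeds `2` for every `n ≥ 1`: `27 n⁴ / 4 < (n² + n)³`. [folklore] -/
theorem two_lt_bigcenBarrierValue (hn : 1 ≤ n) :
    2 < 2 * Real.logb 2 ((n : ℝ) ^ 2 + n) / (Real.logb 2 3 - 2 / 3 + 4 / 3 * Real.logb 2 n) := by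
  have hc := bcExponent_pos hn
  have hn0 : (0 : ℝ) < n := by exact_mod_cast hn
  have hn1 : (1 : ℝ) ≤ n := by exact_mod_cast hn
  rw [lt_div_iff₀ hc]
  suffices h : Real.logb 2 3 - 2 / 3 + 4 / 3 * Real.logb 2 n < Real.logb 2 ((n : ℝ) ^ 2 + n) by
    linarith
  have hB : 0 ≤ ((n : ℝ) - 1) * ((n : ℝ) ^ 2 + 4 * n - 1) := mul_nonneg (by linarith) (by nlinarith)
  have hA : (8 : ℝ) * n ≤ (n + 1) ^ 3 := by nlinarith [hB]
  have hC : (8 : ℝ) * n ^ 4 ≤ ((n : ℝ) ^ 2 + n) ^ 3 := by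
    have h := mul_le_mul_of_nonneg_left hA (pow_nonneg hn0.le 3)
    calc (8 : ℝ) * n ^ 4 = (n : ℝ) ^ 3 * (8 * n) := by ring
      _ ≤ (n : ℝ) ^ 3 * (n + 1) ^ 3 := h
      _ = ((n : ℝ) ^ 2 + n) ^ 3 := by ring
  have key : (27 : ℝ) * (n : ℝ) ^ 4 / 4 < ((n : ℝ) ^ 2 + n) ^ 3 := by
    have h4 : (0 : ℝ) < (n : ℝ) ^ 4 := pow_pos hn0 4
    linarith
  have hlog := Real.logb_lt_logb one_lt_two (by positivity) key
  rw [Real.logb_div (by positivity) (by norm_num), Real.logb_mul (by norm_num) (by positivity),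
    Real.logb_pow, Real.logb_pow, show (27 : ℝ) = 3 ^ 3 by norm_num, Real.logb_pow,
    show (4 : ℝ) = 2 ^ 2 by norm_num, Real.logb_pow, Real.logb_self_eq_one one_lt_two] at hlog
  push_cast at hlog
  linarith

/-- **No balanced big centroid tensor can prove `ω = 2`**: through `T_n` (`n ≥ 2`, any field) the
certified bound `ω(⟨2⟩, T_n) · ω(T_n, ⟨2,2,2⟩)` is `> 2`. [cite: ChristandlVranaZuiddam2021, §3.1]
[cite: KassabovEtAl2026, Thm. 2.7] -/
theorem irreversibilityBarrier_bigcen_gt_two (K : Type) [Field K] (hn : 2 ≤ n) :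
    2 < relativeExponent (unitTensor K 2) (bigcenTensor K n) *
      relativeExponent (bigcenTensor K n) (matMulTensor K 2 2 2) :=
  (two_lt_bigcenBarrierValue (by omega)).trans_le (irreversibilityBarrier_bigcen K hn)

end BigCentroid

end Summit.MatrixMultiplication.MatrixMultiplication.Theorems
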